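import Summits.AtomisticToContinuum.HydrodynamicLimit.Theorems.AprioriBounds.Negative.EquilibriumRung
import Summits.AtomisticToContinuum.HydrodynamicLimit.Theorems.AprioriBounds.Negative.FlowInvariance
import Summits.AtomisticToContinuum.HydrodynamicLimit.Theorems.AprioriBounds.Negative.CriticalLambda
import Literature.Analysis.FluidPDE.HardSphereFlowJointMeasurable
import Literature.Analysis.FluidPDE.HardSphereTrajectoryMeasurable
import Literature.MathematicalPhysics.KineticTheory.HardSphereBBGKYLiouvilleFlow
import Literature.MathematicalPhysics.KineticTheory.HardSphereUniformGas
import Literature.MathematicalPhysics.KineticTheory.HardSphereEulerProofs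
import Literature.Analysis.FluidPDE.BoltzmannEquationProofs
import Literature.MathematicalPhysics.KineticTheory.HardTetherChain
import HarnessLib

/-!
# Equilibrium statics and flow invariance for component (i) of the a-priori crux

Supporting file (1 of 2) of the line `Sketch` for the crux `AprioriBounds` (stmt-AtomisticToContinuum-14827;
`StiffCollisionalRelaxation.AprioriBounds` = `CollisionIsometryCLT.AprioriBoundsPreShock`), lead prover
`prover-line-stmt-AtomisticToContinuum-14827-c1-0`, stub `stub_partOne` (= component (i) of the crux).  The
companion file `StiffCollisionalRelaxationAprioriBoundsEquilibriumPartOne.lean` assembles from these lemmas the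
EQUILIBRIUM RUNG of (i) for EVERY hard-sphere flow (`partOneAt_equilibrium`).

* §1 INVARIANCE FOR AN ARBITRARY FLOW (`measurePreserving_flow_localGibbsMeasure_homogeneous`): the
  homogeneous local Gibbs law `P_N` (profiles `(1, θ₀, 0)`) has Liouville density
  `Z⁻¹ 𝟙_D (2πθ₀)^{-3(N+1)/2} e^{-E(z)/θ₀}` (`AprioriBoundsNegative.tensorPow_homogeneous_eq`), a function of
  the kinetic energy; EVERY `HardSphereFlow` preserves the Liouville measure and conserves the energy along
  the orbits of its Liouville-conull good set (`HardSphereFlow.configEnergy_flow`), so the density is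
  invariant almost everywhere and each `Φ_s` preserves `P_N` (`HardTether.measurePreserving_withDensity_of_ae_eq`).
  (The disprover's `measurePreserving_regFlow_localGibbsMeasure` is the special case of Alexander's
  regularised flow; here nothing is used beyond the `HardSphereFlow` interface.)
* §2 STATIC L² LAW OF LARGE NUMBERS (`lintegral_sq_expAvg_sub_le`): under `P_N` positions and velocities
  are independent and the velocities i.i.d. `N(0, θ₀)` (`localGibbsMeasure_rung0_eq_map`), so the
  empirical exponential moment `G_N = (N+1)⁻¹∑ᵢ e^{λ|vᵢ|²}` has
  `E_{P_N}(G_N − m)² ≤ Var(e^{λ|v|²})/(N+1)`, finite for `λ < 1/(4θ₀)` (Bienaymé, `lintegral_avg_sq_pi_le`;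
  `memLp_two_exp_mul_sq_norm_gaussMeasure`).
* §3 MEASURABILITY AND TONELLI ALONG THE FLOW (`aemeasurable_comp_flow_prod`,
  `lintegral_lintegral_comp_flow_eq`): for a law carried by the good set and invariant under every `Φ_s`,
  `∫(∫ H(Φ_s z) dν(s)) dP = (∫ H dP)·ν(ℝ)` (joint measurability of the flow on `good × ℝ`,
  `HardSphereFlow.measurable_flow_prod_torus`).

No new definitions, no named facts; axioms `propext`, `Classical.choice`, `Quot.sound`.
-/

noncomputable section

open MeasureTheory ProbabilityTheory Filter Set Topology
open scoped ENNReal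

namespace Summit.AtomisticToContinuum.HydrodynamicLimit.Theorems.AdiabatCeiling

open Literature.MathematicalPhysics.KineticTheory Literature.Analysis.FluidPDE

/-! ## §1 Invariance of the homogeneous local Gibbs law under every hard-sphere flow -/

/-- **The homogeneous canonical density is invariant along every hard-sphere flow on its good set**:
for a good point `z` of a hard-sphere flow `Φ` on `𝕋³`, the canonical density of the profile
`(a₀, u₀, θ₀) = (1, 0, θ₀)` takes the same value at `Φ_s z` and at `z` (both lie in the hard-sphere domain,
and the density there is `Z⁻¹ (2πθ₀)^{-3n/2} e^{-E/θ₀}` with `E(Φ_s z) = E(z)`). -/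
theorem canonicalDensity_homogeneous_flow {ε θ₀ : ℝ} {n : ℕ}
    (Φ : HardSphereFlow (Torus.geometry (Fin 3)) ε n) (s : ℝ) {z : Config n (Fin 3) T3}
    (hz : z ∈ Φ.good) :
    canonicalDensity (Torus.geometry (Fin 3)) ε n
        (localGibbsProfile (fun _ => 1) (fun _ => (0 : V3)) (fun _ => θ₀)) (Φ.flow s z) =
      canonicalDensity (Torus.geometry (Fin 3)) ε n
        (localGibbsProfile (fun _ => 1) (fun _ => (0 : V3)) (fun _ => θ₀)) z := by
  unfold canonicalDensity
  congr 1
  have hw : Φ.flow s z ∈ Φ.good := Φ.mapsTo_good s hz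
  rw [Set.indicator_of_mem (Φ.good_subset hw), Set.indicator_of_mem (Φ.good_subset hz),
    AprioriBoundsNegative.tensorPow_homogeneous_eq, AprioriBoundsNegative.tensorPow_homogeneous_eq,
    Φ.configEnergy_flow hz s]

/-- **The homogeneous local Gibbs law is invariant under EVERY hard-sphere flow** (any `σ`, any
`θ₀`, every `N`, every time): Liouville invariance of the flow (`HardSphereFlow.measurePreserving`) and
almost-everywhere invariance of the canonical density (`canonicalDensity_homogeneous_flow` on the
Liouville-conull good set). -/
theorem measurePreserving_flow_localGibbsMeasure_homogeneous (σ θ₀ : ℝ) (N : ℕ)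
    (Φ : HardSphereFlow (Torus.geometry (Fin 3)) (hsDiameter σ N) (N + 1)) (s : ℝ) :
    MeasurePreserving (Φ.flow s)
      (localGibbsMeasure σ (fun _ => 1) (fun _ => 0) (fun _ => θ₀) N)
      (localGibbsMeasure σ (fun _ => 1) (fun _ => 0) (fun _ => θ₀) N) := by
  have hP : localGibbsMeasure σ (fun _ => 1) (fun _ => 0) (fun _ => θ₀) N =
      (liouville (Torus.geometry (Fin 3)) (N + 1) (hsDiameter σ N)).withDensity fun z =>
        ENNReal.ofReal (canonicalDensity (Torus.geometry (Fin 3)) (hsDiameter σ N) (N + 1)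
          (localGibbsProfile (fun _ => 1) (fun _ => (0 : V3)) (fun _ => θ₀)) z) := by
    rw [← localGibbsLaw_eq σ (fun _ => 1) (fun _ => 0) (fun _ => θ₀) N Φ]
    rfl
  rw [hP]
  refine Literature.MathematicalPhysics.KineticTheory.HeatConduction.HardTether.measurePreserving_withDensity_of_ae_eq
    (Φ.measurePreserving s)
    (measurable_canonicalDensity _ _
      (measurable_localGibbsProfile continuous_const continuous_const continuous_const)).ennreal_ofReal
    ?_
  filter_upwards [Φ.ae_mem_good] with z hz
  rw [canonicalDensity_homogeneous_flow Φ s hz]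

/-- **Flow invariance of the homogeneous local Gibbs law, quantifier form** (registered sub-goal of
`stub_partOne`'s equilibrium rung): for all `σ, θ₀, N`, every hard-sphere flow `Φ` of `N + 1` spheres of
diameter `σ(N+1)^{-1/3}` on `𝕋³` and every time `s`, `Φ_s` preserves `localGibbsMeasure σ 1 0 θ₀ N`. -/
theorem flow_invariance_homogeneous :
    ∀ (σ θ₀ : ℝ) (N : ℕ) (Φ : HardSphereFlow (Torus.geometry (Fin 3)) (hsDiameter σ N) (N + 1)) (s : ℝ),
      MeasurePreserving (Φ.flow s) (localGibbsMeasure σ (fun _ => 1) (fun _ => 0) (fun _ => θ₀) N)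
        (localGibbsMeasure σ (fun _ => 1) (fun _ => 0) (fun _ => θ₀) N) :=
  measurePreserving_flow_localGibbsMeasure_homogeneous

/-! ## §2 The static L² law of large numbers for the empirical exponential moment -/

/-- **L² law of large numbers for an average of independent centred variables** (L² form of
`pi_measure_avg_ge_le`): on the product of the probability spaces `(V, μ i)`, for centred
`X i ∈ L²(μ i)` with `Var X i ≤ B`, `∫ (n⁻¹ ∑ᵢ Xᵢ(vᵢ))² d(⊗μ) ≤ B / n`, `n = card ι` (Bienaymé). -/
theorem lintegral_avg_sq_pi_le {ι : Type*} [Fintype ι] {V : Type*} [MeasurableSpace V]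
    (μ : ι → Measure V) [∀ i, IsProbabilityMeasure (μ i)]
    (X : ι → V → ℝ) (hX : ∀ i, MemLp (X i) 2 (μ i)) (h0 : ∀ i, ∫ v, X i v ∂μ i = 0)
    {B : ℝ} (hB : ∀ i, Var[X i; μ i] ≤ B) [Nonempty ι] :
    ∫⁻ v, ENNReal.ofReal (((Fintype.card ι : ℝ)⁻¹ * ∑ i, X i (v i)) ^ 2) ∂Measure.pi μ ≤
      ENNReal.ofReal (B / Fintype.card ι) := by
  set n : ℕ := Fintype.card ι with hn
  have hnpos : (0 : ℝ) < n := by exact_mod_cast Fintype.card_pos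
  set S : (ι → V) → ℝ := ∑ i, fun v => X i (v i) with hS
  have hSi : ∀ i, MemLp (fun v : ι → V => X i (v i)) 2 (Measure.pi μ) := fun i =>
    (hX i).comp_measurePreserving (measurePreserving_eval μ i)
  have hSm : MemLp S 2 (Measure.pi μ) := memLp_finsetSum' _ fun i _ => hSi i
  have hSapply : ∀ v, S v = ∑ i, X i (v i) := fun v => by simp [hS]
  have hmean_i : ∀ i, ∫ v, X i (v i) ∂Measure.pi μ = 0 := by
    intro i
    have h := integral_map (μ := Measure.pi μ) (measurable_pi_apply i).aemeasurable
      (f := X i) (by rw [(measurePreserving_eval μ i).map_eq]; exact (hX i).aestronglyMeasurable)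
    rw [(measurePreserving_eval μ i).map_eq] at h
    rw [← h, h0 i]
  have hmean : ∫ v, S v ∂Measure.pi μ = 0 := by
    simp_rw [hSapply]
    rw [integral_finsetSum _ fun i _ => (hSi i).integrable one_le_two]
    simp [hmean_i]
  have hvar : Var[S; Measure.pi μ] ≤ n * B := by
    rw [hS, variance_sum_pi hX]
    calc ∑ i, Var[X i; μ i] ≤ ∑ _i : ι, B := Finset.sum_le_sum fun i _ => hB i
      _ = n * B := by simp [hn]
  -- `∫ S² = Var S`
  have hS2 : ∫ v, S v ^ 2 ∂Measure.pi μ = Var[S; Measure.pi μ] := by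
    rw [variance_eq_sub hSm, hmean]
    simp
  have hint : Integrable (fun v => ((n : ℝ)⁻¹ * S v) ^ 2) (Measure.pi μ) := by
    have h := (hSm.const_mul (n : ℝ)⁻¹).integrable_sq
    exact h
  calc ∫⁻ v, ENNReal.ofReal (((n : ℝ)⁻¹ * ∑ i, X i (v i)) ^ 2) ∂Measure.pi μ
      = ∫⁻ v, ENNReal.ofReal (((n : ℝ)⁻¹ * S v) ^ 2) ∂Measure.pi μ := by simp_rw [hSapply]
    _ = ENNReal.ofReal (∫ v, ((n : ℝ)⁻¹ * S v) ^ 2 ∂Measure.pi μ) :=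
        (ofReal_integral_eq_lintegral_ofReal hint (ae_of_all _ fun v => sq_nonneg _)).symm
    _ = ENNReal.ofReal (((n : ℝ)⁻¹) ^ 2 * Var[S; Measure.pi μ]) := by
        congr 1
        simp_rw [mul_pow]
        rw [integral_const_mul, hS2]
    _ ≤ ENNReal.ofReal (B / n) := by
        refine ENNReal.ofReal_le_ofReal ?_
        calc ((n : ℝ)⁻¹) ^ 2 * Var[S; Measure.pi μ] ≤ ((n : ℝ)⁻¹) ^ 2 * (n * B) :=
              mul_le_mul_of_nonneg_left hvar (by positivity)
          _ = B / n := by field_simp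

/-- The exponential velocity weight `e^{λ|v|²}` is square integrable under the Maxwellian `N(0, θ₀)`
for `λ < 1/(4θ₀)` (its square against the Gaussian density is the integrable Gaussian
`(2πθ₀)^{-3/2} e^{-(1/(2θ₀) − 2λ)|v|²}`). -/
theorem memLp_two_exp_mul_sq_norm_gaussMeasure {θ₀ lam : ℝ} (hθ : 0 < θ₀)
    (hlam : lam < 1 / (4 * θ₀)) :
    MemLp (fun v : V3 => Real.exp (lam * ‖v‖ ^ 2)) 2 (gaussMeasure (0 : V3) θ₀) := by
  have hmeas : AEStronglyMeasurable (fun v : V3 => Real.exp (lam * ‖v‖ ^ 2)) (gaussMeasure (0 : V3) θ₀) :=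
    (by fun_prop : Measurable fun v : V3 => Real.exp (lam * ‖v‖ ^ 2)).aestronglyMeasurable
  rw [memLp_two_iff_integrable_sq hmeas, ← withDensity_localMaxwellian_eq_gaussMeasure hθ (0 : V3),
    integrable_withDensity_iff_integrable_smul'
      (continuous_localMaxwellian 1 θ₀ (0 : V3)).measurable.ennreal_ofReal
      (Eventually.of_forall fun _ => ENNReal.ofReal_lt_top)]
  set b : ℝ := 1 / (2 * θ₀) - 2 * lam with hb
  have hθ0 : θ₀ ≠ 0 := hθ.ne'
  have hbpos : 0 < b := by
    rw [hb, sub_pos]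
    have h4 : 2 * lam < 2 * (1 / (4 * θ₀)) := by linarith
    calc 2 * lam < 2 * (1 / (4 * θ₀)) := h4
      _ = 1 / (2 * θ₀) := by field_simp; ring
  have hg := (Literature.Analysis.FluidPDE.integrable_exp_neg_mul_sq_norm (E := V3) hbpos).const_mul
    ((2 * Real.pi * θ₀) ^ (-(3 : ℝ) / 2))
  have hpt : ∀ v : V3,
      (ENNReal.ofReal (localMaxwellian 1 θ₀ (0 : V3) v)).toReal • Real.exp (lam * ‖v‖ ^ 2) ^ 2 =
        (2 * Real.pi * θ₀) ^ (-(3 : ℝ) / 2) * Real.exp (-b * ‖v‖ ^ 2) := by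
    intro v
    rw [ENNReal.toReal_ofReal (localMaxwellian_nonneg zero_le_one hθ.le (0 : V3) v), smul_eq_mul]
    unfold localMaxwellian
    simp only [one_mul, sub_zero, finrank_euclideanSpace, Fintype.card_fin, Nat.cast_ofNat]
    rw [← Real.exp_nat_mul, mul_assoc, ← Real.exp_add, hb]
    congr 1
    push_cast
    field_simp
    ring
  exact hg.congr (ae_of_all _ fun v => (hpt v).symm)

/-- **Static L² law of large numbers under the homogeneous local Gibbs law.**  For `σ ≤ 1/2`, `θ₀ > 0`,
`λ < 1/(4θ₀)` and every `N`, the empirical exponential moment `G_N(z) = (N+1)⁻¹∑ᵢ e^{λ|vᵢ|²}`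
satisfies `E_{P_N}(G_N − m)² ≤ Var_{N(0,θ₀)}(e^{λ|v|²}) / (N+1)`, `m = E_{N(0,θ₀)} e^{λ|v|²}`: under
`P_N` positions and velocities are independent and the velocities are i.i.d. `N(0, θ₀)`
(`localGibbsMeasure_rung0_eq_map`), so this is Bienaymé (`lintegral_avg_sq_pi_le`). -/
theorem lintegral_sq_expAvg_sub_le {σ θ₀ lam : ℝ} (hσ2 : σ ≤ 1 / 2) (hθ : 0 < θ₀)
    (hlam : lam < 1 / (4 * θ₀)) (N : ℕ) :
    ∫⁻ z, ENNReal.ofReal ((((N + 1 : ℕ) : ℝ)⁻¹ * ∑ i, Real.exp (lam * ‖(z i).2‖ ^ 2) -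
        ∫ v, Real.exp (lam * ‖v‖ ^ 2) ∂gaussMeasure (0 : V3) θ₀) ^ 2)
      ∂localGibbsMeasure σ (fun _ => 1) (fun _ => 0) (fun _ => θ₀) N ≤
    ENNReal.ofReal (Var[fun v : V3 => Real.exp (lam * ‖v‖ ^ 2); gaussMeasure (0 : V3) θ₀] /
      ((N + 1 : ℕ) : ℝ)) := by
  set γ : Measure V3 := gaussMeasure (0 : V3) θ₀ with hγ
  set m : ℝ := ∫ v, Real.exp (lam * ‖v‖ ^ 2) ∂γ with hm
  set F : Config (N + 1) (Fin 3) T3 → ℝ≥0∞ := fun z =>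
    ENNReal.ofReal ((((N + 1 : ℕ) : ℝ)⁻¹ * ∑ i, Real.exp (lam * ‖(z i).2‖ ^ 2) - m) ^ 2) with hF
  have hFm : Measurable F := by
    refine ((measurable_const.mul (Finset.measurable_sum _ fun i _ => ?_)).sub
      measurable_const).pow_const 2 |>.ennreal_ofReal
    exact (measurable_pi_apply i).snd.norm.pow_const 2 |>.const_mul lam |>.exp
  haveI : IsProbabilityMeasure (posGibbsMeasure (fun _ : T3 => (1 : ℝ)) (hsDiameter σ N) (N + 1)) :=
    isProbabilityMeasure_posGibbsMeasure continuous_const (fun _ => one_pos) hσ2 N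
  -- the pulled-back integrand depends on the velocities only
  set g : (Fin (N + 1) → V3) → ℝ≥0∞ := fun v =>
    ENNReal.ofReal ((((N + 1 : ℕ) : ℝ)⁻¹ * ∑ i, Real.exp (lam * ‖v i‖ ^ 2) - m) ^ 2) with hg
  have hgm : Measurable g := by
    refine ((measurable_const.mul (Finset.measurable_sum _ fun i _ => ?_)).sub
      measurable_const).pow_const 2 |>.ennreal_ofReal
    exact (measurable_pi_apply i).norm.pow_const 2 |>.const_mul lam |>.exp
  have hFg : ∀ p : (Fin (N + 1) → T3) × (Fin (N + 1) → V3), F (zipConfig p) = g p.2 := by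
    intro p
    simp [hF, hg, zipConfig_apply]
  have h1 : ∫⁻ z, F z ∂localGibbsMeasure σ (fun _ => 1) (fun _ => 0) (fun _ => θ₀) N =
      ∫⁻ v, g v ∂Measure.pi fun _ : Fin (N + 1) => γ := by
    rw [localGibbsMeasure_rung0_eq_map σ zero_le_one hθ 0 N, lintegral_map hFm measurable_zipConfig]
    simp_rw [hFg]
    rw [lintegral_prod (fun p : (Fin (N + 1) → T3) × (Fin (N + 1) → V3) => g p.2)
      (hgm.comp measurable_snd).aemeasurable]
    simp only [lintegral_const, measure_univ, mul_one]
    rfl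
  rw [h1]
  -- centre the summands: `n⁻¹ ∑ eᵢ − m = n⁻¹ ∑ (eᵢ − m)`
  have hcentre : ∀ v : Fin (N + 1) → V3,
      ((N + 1 : ℕ) : ℝ)⁻¹ * ∑ i, Real.exp (lam * ‖v i‖ ^ 2) - m =
        ((N + 1 : ℕ) : ℝ)⁻¹ * ∑ i, (Real.exp (lam * ‖v i‖ ^ 2) - m) := by
    intro v
    rw [Finset.sum_sub_distrib, Finset.sum_const, Finset.card_univ, Fintype.card_fin,
      nsmul_eq_mul, mul_sub, ← mul_assoc ((N + 1 : ℕ) : ℝ)⁻¹, inv_mul_cancel₀ (by positivity), one_mul]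
  simp_rw [hg, hcentre]
  have hX2 : MemLp (fun v : V3 => Real.exp (lam * ‖v‖ ^ 2) - m) 2 γ :=
    (memLp_two_exp_mul_sq_norm_gaussMeasure hθ hlam).sub (memLp_const m)
  have hX0 : ∫ v, (Real.exp (lam * ‖v‖ ^ 2) - m) ∂γ = 0 := by
    rw [integral_sub ((memLp_two_exp_mul_sq_norm_gaussMeasure hθ hlam).integrable one_le_two)
      (integrable_const m), hm]
    simp [hγ]
  have hvar : Var[fun v : V3 => Real.exp (lam * ‖v‖ ^ 2) - m; γ] =
      Var[fun v : V3 => Real.exp (lam * ‖v‖ ^ 2); γ] :=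
    variance_sub_const
      (by fun_prop : Measurable fun v : V3 => Real.exp (lam * ‖v‖ ^ 2)).aestronglyMeasurable m
  have h := lintegral_avg_sq_pi_le (fun _ : Fin (N + 1) => γ)
    (fun _ v => Real.exp (lam * ‖v‖ ^ 2) - m) (fun _ => hX2) (fun _ => hX0)
    (B := Var[fun v : V3 => Real.exp (lam * ‖v‖ ^ 2); γ]) (fun _ => hvar.le)
  rw [Fintype.card_fin] at h
  exact h

/-! ## §3 Tonelli along the flow and Markov: the equilibrium rung of (i) -/

/-- **Observables composed with a hard-sphere flow are a.e.-jointly measurable** for every law carried by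
the good set: for a measurable `H ≥ 0` on phase space, a measure `P` with `P(goodᶜ) = 0` and an s-finite
measure `ν` on `ℝ`, `(z, s) ↦ H(Φ_s z)` is `P ⊗ ν`-a.e. measurable (on `good × ℝ` the flow is jointly
measurable, `HardSphereFlow.measurable_flow_prod_torus`; extend by `0`). -/
theorem aemeasurable_comp_flow_prod {ε : ℝ} {n : ℕ} (Φ : HardSphereFlow (Torus.geometry (Fin 3)) ε n)
    {H : Config n (Fin 3) T3 → ℝ≥0∞} (hH : Measurable H) {P : Measure (Config n (Fin 3) T3)}
    (hP : P Φ.goodᶜ = 0) (ν : Measure ℝ) [SFinite ν] :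
    AEMeasurable (fun p : Config n (Fin 3) T3 × ℝ => H (Φ.flow p.2 p.1)) (P.prod ν) := by
  classical
  set S : Set (Config n (Fin 3) T3 × ℝ) := Prod.fst ⁻¹' Φ.good with hS
  have hSm : MeasurableSet S := Φ.measurableSet_good.preimage measurable_fst
  have hF : Measurable fun q : Φ.good × ℝ => H (Φ.flow q.2 (q.1 : Config n (Fin 3) T3)) :=
    hH.comp Φ.measurable_flow_prod_torus
  have hι : Measurable fun p : S => ((⟨p.1.1, p.2⟩ : Φ.good), p.1.2) :=
    (measurable_subtype_coe.fst.subtype_mk).prodMk measurable_subtype_coe.snd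
  refine ⟨fun p => if hp : p ∈ S then H (Φ.flow p.2 ((⟨p.1, hp⟩ : Φ.good) : Config n (Fin 3) T3))
    else 0, Measurable.dite (hF.comp hι) measurable_const hSm, ?_⟩
  have hae : ∀ᵐ p ∂(P.prod ν), p ∈ S := by
    rw [ae_iff]
    have hset : {p : Config n (Fin 3) T3 × ℝ | p ∉ S} = Φ.goodᶜ ×ˢ (univ : Set ℝ) := by
      ext p
      simp [hS]
    rw [hset, Measure.prod_prod, hP, zero_mul]
  filter_upwards [hae] with p hp
  rw [dif_pos hp]

/-- **Tonelli along an invariant law**: for a hard-sphere flow `Φ`, a law `P` carried by the good set and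
invariant under every `Φ_s`, a measurable `H ≥ 0` and an s-finite `ν` on `ℝ`,
`∫ (∫ H(Φ_s z) dν(s)) dP(z) = (∫ H dP) · ν(ℝ)`, and the inner time integral is `P`-a.e. measurable. -/
theorem lintegral_lintegral_comp_flow_eq {ε : ℝ} {n : ℕ} (Φ : HardSphereFlow (Torus.geometry (Fin 3)) ε n)
    {H : Config n (Fin 3) T3 → ℝ≥0∞} (hH : Measurable H) {P : Measure (Config n (Fin 3) T3)} [SFinite P]
    (hP : P Φ.goodᶜ = 0) (hinv : ∀ s, MeasurePreserving (Φ.flow s) P P) (ν : Measure ℝ) [SFinite ν] :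
    AEMeasurable (fun z => ∫⁻ s, H (Φ.flow s z) ∂ν) P ∧
      ∫⁻ z, ∫⁻ s, H (Φ.flow s z) ∂ν ∂P = (∫⁻ z, H z ∂P) * ν univ := by
  have hprod := aemeasurable_comp_flow_prod Φ hH hP ν
  refine ⟨hprod.lintegral_prod_right', ?_⟩
  rw [lintegral_lintegral_swap (f := fun z s => H (Φ.flow s z)) hprod]
  have hinner : ∀ s, ∫⁻ z, H (Φ.flow s z) ∂P = ∫⁻ z, H z ∂P := fun s => (hinv s).lintegral_comp hH
  simp_rw [hinner]
  rw [lintegral_const]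

end Summit.AtomisticToContinuum.HydrodynamicLimit.Theorems.AdiabatCeiling
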